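import Summits.ResolutionOfSingularities.ResolutionOfSingularities.Theses.FrobeniusClosing
import Summits.ResolutionOfSingularities.ResolutionOfSingularities.Theorems.ValuativeLuAlphaPTorsorKnownRanges
import Summits.ResolutionOfSingularities.ResolutionOfSingularities.Theorems.ValuativeLuAlphaPTorsorDimTwoCorollaries
import Summits.ResolutionOfSingularities.ResolutionOfSingularities.Theorems.ValuativeLuAlphaPTorsorDiscreteAllDim
import Summits.ResolutionOfSingularities.ResolutionOfSingularities.Theorems.ValuativeLuAlphaPTorsorDenseRangeFinal
import Summits.ResolutionOfSingularities.ResolutionOfSingularities.Theorems.ValuativeLuAlphaPTorsorChartRegular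
import Summits.ResolutionOfSingularities.ResolutionOfSingularities.Theorems.FrobeniusClosingSteerZeroDimPerfect
import Summits.ResolutionOfSingularities.ResolutionOfSingularities.Theorems.FrobeniusClosingSteerSwitchingDefectless
import HarnessLib

/-!
# The crux `FrobeniusClosing.Steer` is EQUIVALENT to its defect core

Crux `FrobeniusClosing.Steer` (item `stmt-ResolutionOfSingularities-16345`, shared verbatim with `WildCones`,
`JacobianBudget`, `EscapeRate`): `IsolatedForcedTermination → ∀ p prime, torsor LU over perfect ground fields`
(local uniformization of `α_p`-torsors `t ^ p = a` over bases regular at the centre, along every valuation; the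
consequent is verbatim `TorsorLUPerfect`, stmt-16158 = `Valuative.LuAlphaPTorsor` (stmt-0641) with
`[PerfectField k]`). Line `switching-dichotomy`, lead seat c1 (2026-08-17), reshape r6.

This file turns the line's whole composition into ONE importable theorem, exactly as the parent crux's line did
(`Theorems.PfaffLine.luAlphaPTorsor_iff_defectCoreFinal`):

* `steer_of_steerDefectCore` — `Steer` follows from its **defect core**: the same conclusion, demanded only for a
  PERFECT ground field `k`, a valuation ring `O` which is ZERO-DIMENSIONAL over `k` and NOT an Abhyankar place
  of `K/k`, NOT dense (for `v`) in any finitely generated Abhyankar subfunction field `F₀ ⊇ k`, NOT discrete of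
  rank one, at a CLOSED-POINT centre of dimension `≥ 3` of the regular base, for a radicand `t ^ p` which is not
  a `p`-th power at the centre and none of whose `ℤ`-derivatives is a unit there, of transcendence degree
  `n ≥ 3` with torsor LU granted at every zero-dimensional valuation in transcendence degree `< n`, and OUTSIDE
  this line's landed range "strongly switching ∧ parameter-archimedean ∧ defectless" — given the antecedent
  `IsolatedForcedTermination`;
* `steer_iff_steerDefectCore` — and conversely (the core is an instance of the crux).

Everything else is PROVED in the tree and assembled here: the zero-dimensional reduction keeping `k` perfect
(`stub_zeroDimPerfect`, p166845), strong induction on `trdeg_k K`, and the landed ranges `luAlphaPTorsor_of_trdeg_le_two`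
(Giraud main induction in dimension `≤ 2`), `luAlphaPTorsor_of_isAbhyankarPlace_of_perfectField` (Knaf–Kuhlmann
2005), `luAlphaPTorsor_of_discrete` (discrete rank one, every dimension), `stub_birationalExit`,
`luAlphaPTorsor_of_ringKrullDim_le_two` (Giraud along `ν`), `luAlphaPTorsor_of_isUnit_derivation` (monogenic
exit), `denseRange3_crux` (Knaf–Kuhlmann 2009 Thm. 1.5 along zero-dimensional valuations, no separability
hypothesis), `isMaximal_centre_of_zeroDim`, and this line's `switchingDefectlessSeq` (p169091: strongly switching
∧ parameter-archimedean ∧ defectless ⇒ torsor LU, via HLOST Lemma 2.7 / Prop. 4.4 and the toroidal exit).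

So the residual of `Steer` is literally a sub-case of the parent crux's registered residual F⁹
(`stub_defectCoreFinal` of stmt-0641): the defect frontier of local uniformization in positive characteristic
(dimension `3`: Cossart–Piltant; dimension `≥ 4`: `Literature.Barriers.ResolutionOfSingularities.DimensionFourFrontier`),
read along the quadratic sequence of the base (eternal `p`-adic cleaning runs; height-one-directed sequences
along a non-exceptional prime divisor; sequences along an essential prime). A planner can file the core as a
statement item and close `stmt-16345` from it by `steer_of_steerDefectCore`.
-/

set_option linter.dupNamespace false

open IsLocalRing
open Literature.AlgebraicGeometry.Resolution
open Summit.ResolutionOfSingularities.ResolutionOfSingularities.Theses.FrobeniusClosing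
  (Steer IsolatedForcedTermination)
open Summit.ResolutionOfSingularities.ResolutionOfSingularities.Theorems.PfaffLine

namespace Summit.ResolutionOfSingularities.ResolutionOfSingularities.Theorems.SwitchingDichotomy

/-- A field with a finitely generated affine model has natural-number transcendence degree.
[cite: Matsumura1987, Thm. 5.6] -/
theorem exists_nat_trdeg_eq {k K : Type} [Field k] [Field K] [Algebra k K] (A : Subalgebra k K)
    (hA : A.FG) (hfr : IsFractionRing A K) : ∃ n : ℕ, Algebra.trdeg k K = n := by
  haveI := hfr
  haveI : Algebra.FiniteType k A := A.fg_iff_finiteType.mp hA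
  obtain ⟨n, -, hn⟩ := exists_ringKrullDim_eq_and_trdeg_eq k A
  exact ⟨n, by rw [trdeg_eq_trdeg_of_isFractionRing A, hn]⟩

/-- **`Steer` follows from its defect core** (line `switching-dichotomy`, reshape r6; see the module
docstring for the list of landed theorems composed). [new] -/
theorem steer_of_steerDefectCore
    (hcore : IsolatedForcedTermination → ∀ p : ℕ, p.Prime → ∀ n : ℕ, 3 ≤ n →
      (∀ (k K : Type) [Field k] [CharP k p] [PerfectField k] [Field K] [Algebra k K]
        (O : ValuationSubring K) (A₀ : Subalgebra k K) (h₀ : A₀.toSubring ≤ O.toSubring) (t : K),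
        Algebra.trdeg k K < (n : Cardinal) →
        (∀ x ∈ O, ∃ f : Polynomial k, f ≠ 0 ∧ Polynomial.aeval x f ∈ O.nonunits) →
        A₀.FG → t ^ p ∈ A₀ → IsFractionRing (Algebra.adjoin k (insert t (A₀ : Set K))) K →
        IsRegularLocalRing (Localization.AtPrime
          (Ideal.comap (Subring.inclusion h₀) (IsLocalRing.maximalIdeal O))) →
        ∃ (A : Subalgebra k K) (h : A.toSubring ≤ O.toSubring), A₀ ≤ A ∧ t ∈ A ∧ A.FG ∧
          IsFractionRing A K ∧ IsRegularLocalRing (Localization.AtPrime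
            (Ideal.comap (Subring.inclusion h) (IsLocalRing.maximalIdeal O)))) →
      ∀ (k K : Type) [Field k] [CharP k p] [PerfectField k] [Field K] [Algebra k K]
        (O : ValuationSubring K) (A₀ : Subalgebra k K) (h₀ : A₀.toSubring ≤ O.toSubring) (t : K),
        A₀.FG → ∀ (htp : t ^ p ∈ A₀), IsFractionRing (Algebra.adjoin k (insert t (A₀ : Set K))) K →
        IsRegularLocalRing (Localization.AtPrime
          (Ideal.comap (Subring.inclusion h₀) (IsLocalRing.maximalIdeal O))) →
        (Ideal.comap (Subring.inclusion h₀) (IsLocalRing.maximalIdeal O)).IsMaximal →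
        (∀ x ∈ O, ∃ f : Polynomial k, f ≠ 0 ∧ Polynomial.aeval x f ∈ O.nonunits) →
        ¬ ringKrullDim (Localization.AtPrime
          (Ideal.comap (Subring.inclusion h₀) (IsLocalRing.maximalIdeal O))) ≤ 2 →
        ¬ IsAbhyankarPlace O (algebraMap k K).fieldRange ⊤ →
        ¬ (∃ F₀ : Subfield K, (algebraMap k K).fieldRange ≤ F₀ ∧ FGOver (algebraMap k K).fieldRange F₀ ∧
            IsAbhyankarPlace O (algebraMap k K).fieldRange F₀ ∧
            ∀ x w : K, w ≠ 0 → ∃ a ∈ F₀, O.valuation (x - a) < O.valuation w) →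
        ¬ (∃ π : K, π ≠ 0 ∧ O.valuation π < 1 ∧
            ∀ z : K, z ≠ 0 → ∃ m : ℤ, O.valuation z = O.valuation π ^ m) →
        (∀ δ : Derivation ℤ (Localization.AtPrime (Ideal.comap (Subring.inclusion h₀)
            (IsLocalRing.maximalIdeal O))) (Localization.AtPrime (Ideal.comap (Subring.inclusion h₀)
            (IsLocalRing.maximalIdeal O))),
          ¬ IsUnit (δ (algebraMap A₀.toSubring (Localization.AtPrime (Ideal.comap
            (Subring.inclusion h₀) (IsLocalRing.maximalIdeal O))) ⟨t ^ p, htp⟩))) →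
        (∀ c : Localization.AtPrime (Ideal.comap (Subring.inclusion h₀) (IsLocalRing.maximalIdeal O)),
          algebraMap A₀.toSubring (Localization.AtPrime (Ideal.comap (Subring.inclusion h₀)
            (IsLocalRing.maximalIdeal O))) ⟨t ^ p, htp⟩ ≠ c ^ p) →
        Algebra.trdeg k K = (n : Cardinal) →
        ¬ ((∀ R : ℕ → Subring K, R 0 = locAtCentre A₀.toSubring O →
              (∀ i, IsQuadraticTransformAlong O (R i) (R (i + 1))) →
              ∀ x : K, x ∈ O → (∃ y ∈ A₀, ∃ z ∈ A₀, z ≠ 0 ∧ x = y / z) → ∃ i, x ∈ R i) ∧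
            (∀ R : ℕ → Subring K, R 0 = locAtCentre A₀.toSubring O →
              (∀ i, IsQuadraticTransformAlong O (R i) (R (i + 1))) →
              ∀ y : K, (∃ a ∈ A₀, ∃ b ∈ A₀, b ≠ 0 ∧ y = a / b) → y ≠ 0 → O.valuation y < 1 →
                ∃ (i : ℕ) (_ : IsLocalRing (R i)) (z : Fin 1 → R i), IsRsopPart z ∧
                  ∃ n : ℕ, O.valuation ((z 0 : R i) : K) ^ n < O.valuation y) ∧
            ¬ (∀ g : K, (∃ a ∈ A₀, ∃ b ∈ A₀, b ≠ 0 ∧ g = a / b) →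
              ∃ w : K, (∃ a ∈ A₀, ∃ b ∈ A₀, b ≠ 0 ∧ w = a / b) ∧
                O.valuation (t ^ p - g ^ p) = O.valuation (w ^ p))) →
        ∃ (A : Subalgebra k K) (h : A.toSubring ≤ O.toSubring), A₀ ≤ A ∧ t ∈ A ∧ A.FG ∧
          IsFractionRing A K ∧ IsRegularLocalRing (Localization.AtPrime
            (Ideal.comap (Subring.inclusion h) (IsLocalRing.maximalIdeal O)))) :
    Steer := by
  intro hT p hp
  apply stub_zeroDimPerfect p hp
  suffices H : ∀ n : ℕ, ∀ (k K : Type) [Field k] [CharP k p] [PerfectField k] [Field K]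
      [Algebra k K] (O : ValuationSubring K) (A₀ : Subalgebra k K)
      (h₀ : A₀.toSubring ≤ O.toSubring) (t : K), Algebra.trdeg k K = (n : Cardinal) →
      (∀ x ∈ O, ∃ f : Polynomial k, f ≠ 0 ∧ Polynomial.aeval x f ∈ O.nonunits) →
      A₀.FG → t ^ p ∈ A₀ → IsFractionRing (Algebra.adjoin k (insert t (A₀ : Set K))) K →
      IsRegularLocalRing (Localization.AtPrime
        (Ideal.comap (Subring.inclusion h₀) (IsLocalRing.maximalIdeal O))) →
      ∃ (A : Subalgebra k K) (h : A.toSubring ≤ O.toSubring), A₀ ≤ A ∧ t ∈ A ∧ A.FG ∧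
        IsFractionRing A K ∧ IsRegularLocalRing (Localization.AtPrime
          (Ideal.comap (Subring.inclusion h) (IsLocalRing.maximalIdeal O))) by
    intro k K _ _ _ _ _ O A₀ h₀ t hzd hfg htp hfr hreg
    obtain ⟨n, hn⟩ := exists_nat_trdeg_eq (Algebra.adjoin k (insert t (A₀ : Set K)))
      (fg_adjoin_insert hfg t) hfr
    exact H n k K O A₀ h₀ t hn hzd hfg htp hfr hreg
  intro n
  induction n using Nat.strong_induction_on with
  | _ n IH =>
    intro k K _ _ _ _ _ O A₀ h₀ t htr hzd hfg htp hfr hreg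
    -- (1) transcendence degree ≤ 2 (Giraud main induction, landed)
    by_cases hle : n ≤ 2
    · have h2' : Algebra.trdeg k K ≤ 2 := by rw [htr]; exact_mod_cast hle
      exact luAlphaPTorsor_of_trdeg_le_two p hp k K O A₀ h₀ t hfg htp hfr hreg h2'
    have hn3 : 3 ≤ n := by omega
    -- (2) Abhyankar places over a perfect ground field (KK05, landed)
    by_cases hA : IsAbhyankarPlace O (algebraMap k K).fieldRange ⊤
    · exact luAlphaPTorsor_of_isAbhyankarPlace_of_perfectField p hp k K O A₀ h₀ t hfg htp hfr hA
    -- (3) discrete rank one, every dimension (landed)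
    by_cases hD : ∃ π : K, π ≠ 0 ∧ O.valuation π < 1 ∧
        ∀ z : K, z ≠ 0 → ∃ m : ℤ, O.valuation z = O.valuation π ^ m
    · exact luAlphaPTorsor_of_discrete p hp k K O A₀ h₀ t hfg htp hfr hreg hD
    -- (4) the birational exit: `t ^ p` is a `p`-th power at the centre (landed)
    by_cases hpow : ∃ c : Localization.AtPrime (Ideal.comap (Subring.inclusion h₀)
        (IsLocalRing.maximalIdeal O)), algebraMap A₀.toSubring (Localization.AtPrime
          (Ideal.comap (Subring.inclusion h₀) (IsLocalRing.maximalIdeal O))) ⟨t ^ p, htp⟩ = c ^ p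
    · exact stub_birationalExit p hp k K O A₀ h₀ t hfg htp hfr hreg hpow
    push Not at hpow
    -- (5) base dimension ≤ 2 at the centre (Giraud along ν, landed)
    by_cases hdim2 : ringKrullDim (Localization.AtPrime (Ideal.comap (Subring.inclusion h₀)
        (IsLocalRing.maximalIdeal O))) ≤ 2
    · exact luAlphaPTorsor_of_ringKrullDim_le_two p hp k K O A₀ h₀ t hfg htp hfr hreg hdim2
    -- (6) a unit ℤ-derivative of the radicand: the monogenic exit (landed)
    by_cases hδ : ∃ δ : Derivation ℤ (Localization.AtPrime (Ideal.comap (Subring.inclusion h₀)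
        (IsLocalRing.maximalIdeal O))) (Localization.AtPrime (Ideal.comap (Subring.inclusion h₀)
        (IsLocalRing.maximalIdeal O))), IsUnit (δ (algebraMap A₀.toSubring (Localization.AtPrime
          (Ideal.comap (Subring.inclusion h₀) (IsLocalRing.maximalIdeal O))) ⟨t ^ p, htp⟩))
    · exact luAlphaPTorsor_of_isUnit_derivation p hp k K O A₀ h₀ t hfg htp hfr hreg hδ
    push Not at hδ
    -- (7) `K` dense in a finitely generated Abhyankar subfunction field (KK09 Thm. 1.5, landed)
    by_cases hdense : ∃ F₀ : Subfield K, (algebraMap k K).fieldRange ≤ F₀ ∧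
        FGOver (algebraMap k K).fieldRange F₀ ∧ IsAbhyankarPlace O (algebraMap k K).fieldRange F₀ ∧
        ∀ x w : K, w ≠ 0 → ∃ a ∈ F₀, O.valuation (x - a) < O.valuation w
    · exact denseRange3_crux p hp k K O A₀ h₀ t hfg htp hfr hzd hdense
    -- the centre of a zero-dimensional valuation is a closed point
    have hmax : (Ideal.comap (Subring.inclusion h₀) (IsLocalRing.maximalIdeal O)).IsMaximal :=
      isMaximal_centre_of_zeroDim O hzd A₀ h₀
    -- the induction hypothesis, repackaged
    have ih : ∀ (k' K' : Type) [Field k'] [CharP k' p] [PerfectField k'] [Field K'] [Algebra k' K']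
        (O' : ValuationSubring K') (A₀' : Subalgebra k' K') (h₀' : A₀'.toSubring ≤ O'.toSubring) (t' : K'),
        Algebra.trdeg k' K' < (n : Cardinal) →
        (∀ x ∈ O', ∃ f : Polynomial k', f ≠ 0 ∧ Polynomial.aeval x f ∈ O'.nonunits) →
        A₀'.FG → t' ^ p ∈ A₀' → IsFractionRing (Algebra.adjoin k' (insert t' (A₀' : Set K'))) K' →
        IsRegularLocalRing (Localization.AtPrime
          (Ideal.comap (Subring.inclusion h₀') (IsLocalRing.maximalIdeal O'))) →
        ∃ (A : Subalgebra k' K') (h : A.toSubring ≤ O'.toSubring), A₀' ≤ A ∧ t' ∈ A ∧ A.FG ∧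
          IsFractionRing A K' ∧ IsRegularLocalRing (Localization.AtPrime
            (Ideal.comap (Subring.inclusion h) (IsLocalRing.maximalIdeal O'))) := by
      intro k' K' _ _ _ _ _ O' A₀' h₀' t' hlt hzd' hfg' htp' hfr' hreg'
      obtain ⟨m, hm⟩ := exists_nat_trdeg_eq (Algebra.adjoin k' (insert t' (A₀' : Set K')))
        (fg_adjoin_insert hfg' t') hfr'
      have hmn : m < n := by rw [hm] at hlt; exact_mod_cast hlt
      exact IH m hmn k' K' O' A₀' h₀' t' hm hzd' hfg' htp' hfr' hreg'
    -- (8) strongly switching ∧ parameter-archimedean ∧ defectless (this line's landed range)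
    by_cases hS : (∀ R : ℕ → Subring K, R 0 = locAtCentre A₀.toSubring O →
          (∀ i, IsQuadraticTransformAlong O (R i) (R (i + 1))) →
          ∀ x : K, x ∈ O → (∃ y ∈ A₀, ∃ z ∈ A₀, z ≠ 0 ∧ x = y / z) → ∃ i, x ∈ R i) ∧
        (∀ R : ℕ → Subring K, R 0 = locAtCentre A₀.toSubring O →
          (∀ i, IsQuadraticTransformAlong O (R i) (R (i + 1))) →
          ∀ y : K, (∃ a ∈ A₀, ∃ b ∈ A₀, b ≠ 0 ∧ y = a / b) → y ≠ 0 → O.valuation y < 1 →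
            ∃ (i : ℕ) (_ : IsLocalRing (R i)) (z : Fin 1 → R i), IsRsopPart z ∧
              ∃ n : ℕ, O.valuation ((z 0 : R i) : K) ^ n < O.valuation y) ∧
        ¬ (∀ g : K, (∃ a ∈ A₀, ∃ b ∈ A₀, b ≠ 0 ∧ g = a / b) →
          ∃ w : K, (∃ a ∈ A₀, ∃ b ∈ A₀, b ≠ 0 ∧ w = a / b) ∧
            O.valuation (t ^ p - g ^ p) = O.valuation (w ^ p))
    · exact switchingDefectlessSeq p hp k K O A₀ h₀ t hfg htp hfr hreg hS.1 hS.2.1 hS.2.2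
    -- (9) the defect core
    · exact hcore hT p hp n hn3 ih k K O A₀ h₀ t hfg htp hfr hreg hmax hzd hdim2 hA hdense hD hδ
        hpow htr hS

/-- **`FrobeniusClosing.Steer` is EQUIVALENT to its defect core** (registered anchor
`steer_iff_steerDefectCore` of item `stmt-ResolutionOfSingularities-16345`): the forward direction
instantiates the crux at the core's data (using the core's own hypothesis `IsolatedForcedTermination`), the
backward one is `steer_of_steerDefectCore`. [new] -/
theorem steer_iff_steerDefectCore :
    Steer ↔
    (IsolatedForcedTermination → ∀ p : ℕ, p.Prime → ∀ n : ℕ, 3 ≤ n →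
      (∀ (k K : Type) [Field k] [CharP k p] [PerfectField k] [Field K] [Algebra k K]
        (O : ValuationSubring K) (A₀ : Subalgebra k K) (h₀ : A₀.toSubring ≤ O.toSubring) (t : K),
        Algebra.trdeg k K < (n : Cardinal) →
        (∀ x ∈ O, ∃ f : Polynomial k, f ≠ 0 ∧ Polynomial.aeval x f ∈ O.nonunits) →
        A₀.FG → t ^ p ∈ A₀ → IsFractionRing (Algebra.adjoin k (insert t (A₀ : Set K))) K →
        IsRegularLocalRing (Localization.AtPrime
          (Ideal.comap (Subring.inclusion h₀) (IsLocalRing.maximalIdeal O))) →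
        ∃ (A : Subalgebra k K) (h : A.toSubring ≤ O.toSubring), A₀ ≤ A ∧ t ∈ A ∧ A.FG ∧
          IsFractionRing A K ∧ IsRegularLocalRing (Localization.AtPrime
            (Ideal.comap (Subring.inclusion h) (IsLocalRing.maximalIdeal O)))) →
      ∀ (k K : Type) [Field k] [CharP k p] [PerfectField k] [Field K] [Algebra k K]
        (O : ValuationSubring K) (A₀ : Subalgebra k K) (h₀ : A₀.toSubring ≤ O.toSubring) (t : K),
        A₀.FG → ∀ (htp : t ^ p ∈ A₀), IsFractionRing (Algebra.adjoin k (insert t (A₀ : Set K))) K →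
        IsRegularLocalRing (Localization.AtPrime
          (Ideal.comap (Subring.inclusion h₀) (IsLocalRing.maximalIdeal O))) →
        (Ideal.comap (Subring.inclusion h₀) (IsLocalRing.maximalIdeal O)).IsMaximal →
        (∀ x ∈ O, ∃ f : Polynomial k, f ≠ 0 ∧ Polynomial.aeval x f ∈ O.nonunits) →
        ¬ ringKrullDim (Localization.AtPrime
          (Ideal.comap (Subring.inclusion h₀) (IsLocalRing.maximalIdeal O))) ≤ 2 →
        ¬ IsAbhyankarPlace O (algebraMap k K).fieldRange ⊤ →
        ¬ (∃ F₀ : Subfield K, (algebraMap k K).fieldRange ≤ F₀ ∧ FGOver (algebraMap k K).fieldRange F₀ ∧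
            IsAbhyankarPlace O (algebraMap k K).fieldRange F₀ ∧
            ∀ x w : K, w ≠ 0 → ∃ a ∈ F₀, O.valuation (x - a) < O.valuation w) →
        ¬ (∃ π : K, π ≠ 0 ∧ O.valuation π < 1 ∧
            ∀ z : K, z ≠ 0 → ∃ m : ℤ, O.valuation z = O.valuation π ^ m) →
        (∀ δ : Derivation ℤ (Localization.AtPrime (Ideal.comap (Subring.inclusion h₀)
            (IsLocalRing.maximalIdeal O))) (Localization.AtPrime (Ideal.comap (Subring.inclusion h₀)
            (IsLocalRing.maximalIdeal O))),
          ¬ IsUnit (δ (algebraMap A₀.toSubring (Localization.AtPrime (Ideal.comap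
            (Subring.inclusion h₀) (IsLocalRing.maximalIdeal O))) ⟨t ^ p, htp⟩))) →
        (∀ c : Localization.AtPrime (Ideal.comap (Subring.inclusion h₀) (IsLocalRing.maximalIdeal O)),
          algebraMap A₀.toSubring (Localization.AtPrime (Ideal.comap (Subring.inclusion h₀)
            (IsLocalRing.maximalIdeal O))) ⟨t ^ p, htp⟩ ≠ c ^ p) →
        Algebra.trdeg k K = (n : Cardinal) →
        ¬ ((∀ R : ℕ → Subring K, R 0 = locAtCentre A₀.toSubring O →
              (∀ i, IsQuadraticTransformAlong O (R i) (R (i + 1))) →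
              ∀ x : K, x ∈ O → (∃ y ∈ A₀, ∃ z ∈ A₀, z ≠ 0 ∧ x = y / z) → ∃ i, x ∈ R i) ∧
            (∀ R : ℕ → Subring K, R 0 = locAtCentre A₀.toSubring O →
              (∀ i, IsQuadraticTransformAlong O (R i) (R (i + 1))) →
              ∀ y : K, (∃ a ∈ A₀, ∃ b ∈ A₀, b ≠ 0 ∧ y = a / b) → y ≠ 0 → O.valuation y < 1 →
                ∃ (i : ℕ) (_ : IsLocalRing (R i)) (z : Fin 1 → R i), IsRsopPart z ∧
                  ∃ n : ℕ, O.valuation ((z 0 : R i) : K) ^ n < O.valuation y) ∧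
            ¬ (∀ g : K, (∃ a ∈ A₀, ∃ b ∈ A₀, b ≠ 0 ∧ g = a / b) →
              ∃ w : K, (∃ a ∈ A₀, ∃ b ∈ A₀, b ≠ 0 ∧ w = a / b) ∧
                O.valuation (t ^ p - g ^ p) = O.valuation (w ^ p))) →
        ∃ (A : Subalgebra k K) (h : A.toSubring ≤ O.toSubring), A₀ ≤ A ∧ t ∈ A ∧ A.FG ∧
          IsFractionRing A K ∧ IsRegularLocalRing (Localization.AtPrime
            (Ideal.comap (Subring.inclusion h) (IsLocalRing.maximalIdeal O)))) := by
  refine ⟨fun h => ?_, steer_of_steerDefectCore⟩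
  intro hT p hp n _ _ k K _ _ _ _ _ O A₀ h₀ t hfg htp hfr hreg _ _ _ _ _ _ _ _ _ _
  exact h hT p hp k K O A₀ h₀ t hfg htp hfr hreg

end Summit.ResolutionOfSingularities.ResolutionOfSingularities.Theorems.SwitchingDichotomy
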